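import Mathlib.Analysis.Calculus.FDeriv.Linear
import Mathlib.Analysis.InnerProductSpace.Orthogonal
import Mathlib.LinearAlgebra.LinearIndependent.Lemmas
import Mathlib.LinearAlgebra.Matrix.NonsingularInverse
import Mathlib.Topology.Algebra.Module.FiniteDimension
import Literature.Geometry.Symplectic.StandardEnd
import Literature.Geometry.Symplectic.PfaffianFour

/-!
# Stub `helper_isStabilising_roundContactSphere` of line `stable-seam-host` for crux
`OrigamiFoldExistence` (item stmt-SmoothPoincare4-7844, route route-SmoothPoincare4-SymplecticOrigami)

The MODEL instance of the line's predicate "`θ` stabilises the seam trace `σ` on the unit sphere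
`S³ ⊂ ℝ⁴`" (Cieliebak–Volkov stable Hamiltonian structure, written orientation-free in a chart):
the round contact sphere, i.e. the trace `σ₀(u)(v, w) = ω₀(v, w)` of the unit sphere of
`(ℝ⁴, ω₀)`, `ω₀ = dx₀ ∧ dx₁ + dx₂ ∧ dx₃` (`Literature.Geometry.Symplectic.stdSymplecticForm`), is
stabilised by the standard contact (Liouville) form `θ₀(u) = ½ ω₀(u, ·)`:

* `θ₀` is (the coercion of) a continuous linear map `ℝ⁴ →L ℝ⁴ →L ℝ`, hence `C^∞` with
  `Dθ₀(u) = θ₀` (`ContinuousLinearMap.fderiv`);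
* (ii) `dθ₀ = ω₀`: `Dθ₀(u)(v)(w) - Dθ₀(u)(w)(v) = ½ ω₀(v, w) - ½ ω₀(w, v) = ω₀(v, w)`, which
  vanishes for `v ∈ ker σ₀(u)|_{u^⊥}` and `w ⊥ u`;
* (i) the PFAFFIAN IDENTITY `ω₀(a,b) ω₀(c,d) - ω₀(a,c) ω₀(b,d) + ω₀(a,d) ω₀(b,c) = det[a,b,c,d]`
  (`½ ω₀ ∧ ω₀ = dx₀₁₂₃`; a polynomial identity, `ring` after the Laplace expansion
  `Literature.Geometry.Symplectic.matrix_det_fin_four`), so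
  `(θ₀ ∧ σ₀)_u(v₀, v₁, v₂) = ½ det[u, v₀, v₁, v₂] ≠ 0` for every linearly independent triple
  `v ⊥ u`, because `u ∉ span v ⊆ u^⊥` (`⟪u, u⟫ = 1`) makes `(u, v₀, v₁, v₂)` a basis
  (`LinearIndependent.finCons`, `Matrix.linearIndependent_rows_iff_isUnit`).

Sources: K. Cieliebak, E. Volkov, *First steps in stable Hamiltonian topology*, JEMS 17 (2015),
§1 (the contact case of a stable Hamiltonian structure); folklore linear algebra.
-/

noncomputable section

-- the prescribed namespace `Summit.<P>.<Sub>.…` duplicates `SmoothPoincare4` (P = Sub)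
set_option linter.dupNamespace false

open scoped Manifold ContDiff Topology RealInnerProductSpace
open Set Function
open Literature.Geometry.Symplectic

namespace Summit.SmoothPoincare4.SmoothPoincare4.Theorems.OrigamiFoldExistence.StableSeamHost

/-! ### `ω₀(u, ·)` as a continuous linear map in `u` -/

/-- The standard symplectic form `ω₀` of `ℝ⁴` is (the coercion of) a continuous bilinear map
`ℝ⁴ →L ℝ⁴ →L ℝ` (stated as an existence so that no definition is added). [folklore] -/
theorem exists_clm_stdSymplecticForm :
    ∃ L : EuclideanSpace ℝ (Fin 4) →L[ℝ] EuclideanSpace ℝ (Fin 4) →L[ℝ] ℝ,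
      ∀ a b : EuclideanSpace ℝ (Fin 4), L a b = stdSymplecticForm a b := by
  let B : EuclideanSpace ℝ (Fin 4) →ₗ[ℝ] EuclideanSpace ℝ (Fin 4) →ₗ[ℝ] ℝ :=
    LinearMap.mk₂ ℝ stdSymplecticForm
      (fun a a' b => by simp only [stdSymplecticForm, PiLp.add_apply]; ring)
      (fun c a b => by simp only [stdSymplecticForm, PiLp.smul_apply, smul_eq_mul]; ring)
      (fun a b b' => by simp only [stdSymplecticForm, PiLp.add_apply]; ring)
      (fun c a b => by simp only [stdSymplecticForm, PiLp.smul_apply, smul_eq_mul]; ring)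
  refine ⟨LinearMap.toContinuousLinearMap
      ((LinearMap.toContinuousLinearMap :
          (EuclideanSpace ℝ (Fin 4) →ₗ[ℝ] ℝ) ≃ₗ[ℝ] EuclideanSpace ℝ (Fin 4) →L[ℝ] ℝ).toLinearMap
        ∘ₗ B), fun a b => ?_⟩
  rfl

/-! ### The Pfaffian identity `½ ω₀ ∧ ω₀ = det` and the volume of a frame `(u, v) `, `v ⊥ u` -/

/-- **Pfaffian identity** for `ω₀ = dx₀ ∧ dx₁ + dx₂ ∧ dx₃`:
`ω₀(w₀,w₁) ω₀(w₂,w₃) - ω₀(w₀,w₂) ω₀(w₁,w₃) + ω₀(w₀,w₃) ω₀(w₁,w₂) = det (wᵢⱼ)` (`½ ω₀ ∧ ω₀` is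
the standard volume form). [folklore] -/
theorem stdSymplecticForm_halfWedgeSq_eq_det (w : Fin 4 → EuclideanSpace ℝ (Fin 4)) :
    stdSymplecticForm (w 0) (w 1) * stdSymplecticForm (w 2) (w 3)
        - stdSymplecticForm (w 0) (w 2) * stdSymplecticForm (w 1) (w 3)
        + stdSymplecticForm (w 0) (w 3) * stdSymplecticForm (w 1) (w 2)
      = (Matrix.of fun i j => w i j).det := by
  rw [matrix_det_fin_four]
  simp only [Matrix.of_apply, stdSymplecticForm]
  ring

/-- A linearly independent triple `v` orthogonal to a unit vector `u` completes it to a frame: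
`det[u, v₀, v₁, v₂] ≠ 0`. [folklore] -/
theorem det_finCons_ne_zero (u : EuclideanSpace ℝ (Fin 4)) (hu : ‖u‖ = 1)
    (v : Fin 3 → EuclideanSpace ℝ (Fin 4)) (hvu : ∀ i, ⟪v i, u⟫ = 0)
    (hv : LinearIndependent ℝ v) :
    (Matrix.of fun i j => (Fin.cons u v : Fin 4 → EuclideanSpace ℝ (Fin 4)) i j).det ≠ 0 := by
  -- `u ∉ span v`, since `span v ⊆ u^⊥` and `⟪u, u⟫ = 1`
  have hnot : u ∉ Submodule.span ℝ (range v) := by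
    intro hmem
    have hle : Submodule.span ℝ (range v) ≤ (ℝ ∙ u)ᗮ := by
      rw [Submodule.span_le]
      rintro _ ⟨i, rfl⟩
      exact Submodule.mem_orthogonal_singleton_iff_inner_left.2 (hvu i)
    have h0 : ⟪u, u⟫ = 0 := Submodule.mem_orthogonal_singleton_iff_inner_left.1 (hle hmem)
    rw [real_inner_self_eq_norm_sq, hu] at h0
    norm_num at h0
  have hw : LinearIndependent ℝ (Fin.cons u v : Fin 4 → EuclideanSpace ℝ (Fin 4)) := hv.finCons hnot
  -- the rows of the coordinate matrix are the image of the frame under `WithLp.ofLp`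
  have hrows : LinearIndependent ℝ
      (Matrix.of fun i j => (Fin.cons u v : Fin 4 → EuclideanSpace ℝ (Fin 4)) i j).row :=
    hw.map' (WithLp.linearEquiv 2 ℝ (Fin 4 → ℝ)).toLinearMap (LinearEquiv.ker _)
  have hunit := Matrix.linearIndependent_rows_iff_isUnit.1 hrows
  rw [Matrix.isUnit_iff_isUnit_det, isUnit_iff_ne_zero] at hunit
  exact hunit

/-! ### The registered signature -/

/-- **The round contact sphere is a stable seam** (model instance of the line's `IsStabilising`):
the standard contact form `θ₀(u) = ½ ω₀(u, ·)` of `S³ ⊂ (ℝ⁴, ω₀)` is smooth, `θ₀ ∧ ω₀ ≠ 0` on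
every linearly independent tangent triple of the unit sphere (it equals `½ det[u, v₀, v₁, v₂]` by
the Pfaffian identity), and `ker ω₀|_{u^⊥} ⊂ ker dθ₀` (indeed `dθ₀ = ω₀`).  Cieliebak–Volkov, JEMS 17
(2015), §1: a contact form is a stabilising form for `dα`. [folklore] -/
theorem helper_isStabilising_roundContactSphere :
    ∃ θ : EuclideanSpace ℝ (Fin 4) → EuclideanSpace ℝ (Fin 4) →L[ℝ] ℝ, (∀ u v : EuclideanSpace ℝ (Fin 4), θ u v = 2⁻¹ * Literature.Geometry.Symplectic.stdSymplecticForm u v) ∧ ContDiff ℝ ∞ θ ∧ (∀ u : EuclideanSpace ℝ (Fin 4), ‖u‖ = 1 → ∀ v : Fin 3 → EuclideanSpace ℝ (Fin 4), (∀ i, ⟪v i, u⟫ = 0) → LinearIndependent ℝ v → θ u (v 0) * Literature.Geometry.Symplectic.stdSymplecticForm (v 1) (v 2) - θ u (v 1) * Literature.Geometry.Symplectic.stdSymplecticForm (v 0) (v 2) + θ u (v 2) * Literature.Geometry.Symplectic.stdSymplecticForm (v 0) (v 1) ≠ 0) ∧ (∀ u : EuclideanSpace ℝ (Fin 4), ‖u‖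 = 1 → ∀ v : EuclideanSpace ℝ (Fin 4), ⟪v, u⟫ = 0 → (∀ w : EuclideanSpace ℝ (Fin 4), ⟪w, u⟫ = 0 → Literature.Geometry.Symplectic.stdSymplecticForm v w = 0) → ∀ w : EuclideanSpace ℝ (Fin 4), ⟪w, u⟫ = 0 → fderiv ℝ θ u v w - fderiv ℝ θ u w v = 0) := by
  obtain ⟨L, hL⟩ := exists_clm_stdSymplecticForm
  refine ⟨⇑((2⁻¹ : ℝ) • L), fun u v => ?_, ((2⁻¹ : ℝ) • L).contDiff, ?_, ?_⟩
  · simp only [smul_apply, hL, smul_eq_mul]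
  · intro u hu v hvu hv
    have hdet := det_finCons_ne_zero u hu v hvu hv
    rw [← stdSymplecticForm_halfWedgeSq_eq_det] at hdet
    have h1 : (Fin.cons u v : Fin 4 → EuclideanSpace ℝ (Fin 4)) 1 = v 0 := rfl
    have h2 : (Fin.cons u v : Fin 4 → EuclideanSpace ℝ (Fin 4)) 2 = v 1 := rfl
    have h3 : (Fin.cons u v : Fin 4 → EuclideanSpace ℝ (Fin 4)) 3 = v 2 := rfl
    simp only [Fin.cons_zero, h1, h2, h3] at hdet
    simp only [smul_apply, hL, smul_eq_mul]
    intro h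
    apply hdet
    linarith
  · intro u _ v _ hker w hw
    rw [ContinuousLinearMap.fderiv]
    simp only [smul_apply, hL, smul_eq_mul, stdSymplecticForm_swap v w,
      hker w hw]
    ring

end Summit.SmoothPoincare4.SmoothPoincare4.Theorems.OrigamiFoldExistence.StableSeamHost
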